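import Mathlib

/-!
# `BalabanUV.Beta.FP.LatticeTaylor` — DISCRETE TAYLOR EXPANSIONS ON `ℤ` TO ORDER TWO WITH THIRD-DIFFERENCE REMAINDERS, BOTH SIGNS OF THE STEP
# (road «FP» for binder row D1, LEGS generic Taylor-pairing track, module (T); [folklore] discrete calculus, nothing of the manuscripts)

HONEST DEPENDENCY (page 1, mandatory): continuum YM on T⁴ ⇐ BetaPertH ∧ nine spine estimates (0/9 proved); BetaPertH ⇐ (D1) ∧ (D4) ∧
CAP+tail; G-an2-4 gates asym, D1 and NE2/3/4.  HONEST FRAMING (cell contract, verbatim): «discharging `BetaPertH` makes Bałaban's UV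
stability UNCONDITIONAL — a real constructive-QFT result; it is NOT the continuum limit and NOT the Clay problem.»  THIS MODULE is elementary
[folklore] real analysis on the integer lattice (forward differences, telescoping sums); it asserts nothing about Bałaban's objects, cites nothing,
mints no `Prop` fact, 0 `def`, 0 sorry.  Value = the Taylor half of the LEGS row of road FP's N7 (`REP-DESIGN.md` (P3): «infinite-range perfect stencils →
finite table by Taylor pairing; remainders go to `U`»): exponentially localised stencil profiles are paired against legs expanded to SECOND order in the
lattice variables, the THIRD-order remainder being summable in the window.  NOT D1, NOT BetaPertH, NOT continuum, NOT Clay.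

WHAT IS HERE.
* §1 ONE DIMENSION, `g : ℤ → ℝ`, forward difference `Δ g j = g (j+1) − g j` (Mathlib `fwdDiff 1`): the EXACT telescoping identities
  `g m − g 0 = Σ_{j<m} Δg j`, `g m − g 0 − m·Δg 0 = Σ_{j<m} Σ_{l<j} Δ²g l`, `g m − g 0 − m·Δg 0 − (m(m−1)/2)·Δ²g 0 = Σ_{j<m} Σ_{l<j} Σ_{k<l} Δ³g k`
  for `m : ℕ` and their BACKWARD twins for `g (−n)`, and the resulting BOUNDS for every `m : ℤ` with the SAME Taylor polynomial
  `g 0 + m·Δg 0 + (m(m−1)/2)·Δ²g 0` (forward differences AT THE BASE POINT only): `|remainder| ≤ |m|^k · B` whenever the `k`-th differences are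
  bounded by `B` on the integer segment between `0` and `m` (`abs_taylor0_le`, `abs_taylor1_le`, `abs_taylor2_le`).
NOT HERE: the `ℤ^D` assembly along coordinate paths (`FP/LatticeTaylorPath`), stencil moments, the bubble pairing and its `‖w‖⁻⁷` remainder (next modules
of the track).  Unit `b2b-balaban-beta-d1-formalise-leaf-02` (gen 5).
-/

noncomputable section

namespace Summit.QuantumFields.BalabanUV.Beta.FP.LatticeTaylor

open Finset fwdDiff

/-! ## §1 One dimension: exact telescoping identities and remainder bounds -/

section OneDim

variable (g : ℤ → ℝ)

/-- [folklore] The forward difference with unit step: `Δ_[1] g j = g (j + 1) − g j`. -/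
theorem fwdDiff_one_apply (j : ℤ) : Δ_[1] g j = g (j + 1) - g j := rfl

/-- [folklore] ZEROTH ORDER, forward: `g m − g 0 = Σ_{j<m} Δg j` (`m : ℕ`). -/
theorem sub_eq_sum_fwdDiff (m : ℕ) : g m - g 0 = ∑ j ∈ range m, Δ_[1] g j := by
  induction m with
  | zero => simp
  | succ m ih =>
    rw [sum_range_succ, ← ih, fwdDiff_one_apply]
    push_cast
    ring

/-- [folklore] ZEROTH ORDER, backward: `g (−n) − g 0 = −Σ_{j<n} Δg (−(j+1))` (`n : ℕ`). -/
theorem sub_eq_neg_sum_fwdDiff_neg (n : ℕ) : g (-(n : ℤ)) - g 0 = -∑ j ∈ range n, Δ_[1] g (-((j : ℤ) + 1)) := by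
  induction n with
  | zero => simp
  | succ n ih =>
    rw [sum_range_succ, neg_add, ← ih, fwdDiff_one_apply]
    push_cast
    have : -((n : ℤ) + 1) + 1 = -(n : ℤ) := by ring
    rw [this]
    ring

/-- [folklore] FIRST ORDER, forward: `g m − g 0 − m·Δg 0 = Σ_{j<m} Σ_{l<j} Δ²g l`. -/
theorem taylor1_eq_sum (m : ℕ) :
    g m - g 0 - (m : ℝ) * Δ_[1] g 0 = ∑ j ∈ range m, ∑ l ∈ range j, Δ_[1] (Δ_[1] g) l := by
  have h1 : ∀ j : ℕ, Δ_[1] g j = Δ_[1] g 0 + ∑ l ∈ range j, Δ_[1] (Δ_[1] g) l := by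
    intro j
    have := sub_eq_sum_fwdDiff (Δ_[1] g) j
    linarith
  rw [sub_eq_sum_fwdDiff]
  simp_rw [h1]
  rw [sum_add_distrib, sum_const, card_range, nsmul_eq_mul]
  ring

/-- [folklore] FIRST ORDER, backward: `g (−n) − g 0 + n·Δg 0 = Σ_{j<n} Σ_{l ≤ j} Δ²g (−(l+1))`. -/
theorem taylor1_neg_eq_sum (n : ℕ) :
    g (-(n : ℤ)) - g 0 + (n : ℝ) * Δ_[1] g 0 = ∑ j ∈ range n, ∑ l ∈ range (j + 1), Δ_[1] (Δ_[1] g) (-((l : ℤ) + 1)) := by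
  have h1 : ∀ j : ℕ, Δ_[1] g (-((j : ℤ) + 1)) = Δ_[1] g 0 - ∑ l ∈ range (j + 1), Δ_[1] (Δ_[1] g) (-((l : ℤ) + 1)) := by
    intro j
    have := sub_eq_neg_sum_fwdDiff_neg (Δ_[1] g) (j + 1)
    push_cast at this ⊢
    linarith
  rw [sub_eq_neg_sum_fwdDiff_neg]
  simp_rw [h1]
  rw [sum_sub_distrib, sum_const, card_range, nsmul_eq_mul]
  ring

/-- [folklore] SECOND ORDER, forward: `g m − g 0 − m·Δg 0 − (m(m−1)/2)·Δ²g 0 = Σ_{j<m} Σ_{l<j} Σ_{k<l} Δ³g k`. -/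
theorem taylor2_eq_sum (m : ℕ) :
    g m - g 0 - (m : ℝ) * Δ_[1] g 0 - ((m : ℝ) * ((m : ℝ) - 1) / 2) * Δ_[1] (Δ_[1] g) 0
      = ∑ j ∈ range m, ∑ l ∈ range j, ∑ k ∈ range l, Δ_[1] (Δ_[1] (Δ_[1] g)) k := by
  have h1 : ∀ l : ℕ, Δ_[1] (Δ_[1] g) l = Δ_[1] (Δ_[1] g) 0 + ∑ k ∈ range l, Δ_[1] (Δ_[1] (Δ_[1] g)) k := by
    intro l
    have := sub_eq_sum_fwdDiff (Δ_[1] (Δ_[1] g)) l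
    linarith
  rw [taylor1_eq_sum]
  simp_rw [h1]
  simp_rw [sum_add_distrib, sum_const, card_range, nsmul_eq_mul]
  rw [← sum_mul]
  have hG : ∀ m : ℕ, (∑ j ∈ range m, (j : ℝ)) = (m : ℝ) * ((m : ℝ) - 1) / 2 := by
    intro m
    induction m with
    | zero => simp
    | succ m ih => rw [sum_range_succ, ih]; push_cast; ring
  rw [hG]
  ring

/-- [folklore] SECOND ORDER, backward: `g (−n) − g 0 + n·Δg 0 − (n(n+1)/2)·Δ²g 0 = −Σ_{j<n} Σ_{l≤j} Σ_{k≤l} Δ³g (−(k+1))`. -/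
theorem taylor2_neg_eq_sum (n : ℕ) :
    g (-(n : ℤ)) - g 0 + (n : ℝ) * Δ_[1] g 0 - ((n : ℝ) * ((n : ℝ) + 1) / 2) * Δ_[1] (Δ_[1] g) 0
      = -∑ j ∈ range n, ∑ l ∈ range (j + 1), ∑ k ∈ range (l + 1), Δ_[1] (Δ_[1] (Δ_[1] g)) (-((k : ℤ) + 1)) := by
  have h1 : ∀ l : ℕ, Δ_[1] (Δ_[1] g) (-((l : ℤ) + 1))
      = Δ_[1] (Δ_[1] g) 0 - ∑ k ∈ range (l + 1), Δ_[1] (Δ_[1] (Δ_[1] g)) (-((k : ℤ) + 1)) := by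
    intro l
    have := sub_eq_neg_sum_fwdDiff_neg (Δ_[1] (Δ_[1] g)) (l + 1)
    push_cast at this ⊢
    linarith
  rw [taylor1_neg_eq_sum]
  simp_rw [h1]
  simp_rw [sum_sub_distrib, sum_const, card_range, nsmul_eq_mul]
  rw [← sum_mul]
  have hG : ∀ n : ℕ, (∑ j ∈ range n, (((j + 1 : ℕ) : ℝ))) = (n : ℝ) * ((n : ℝ) + 1) / 2 := by
    intro n
    induction n with
    | zero => simp
    | succ n ih => rw [sum_range_succ, ih]; push_cast; ring
  rw [hG]
  ring

/-- [folklore] A triple range sum of terms bounded by `B` is at most `m³·B`. -/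
theorem abs_sum₃_le {m : ℕ} {a : ℕ → ℝ} {B : ℝ} (hB : 0 ≤ B) (h : ∀ k, k < m → |a k| ≤ B) :
    |∑ j ∈ range m, ∑ l ∈ range j, ∑ k ∈ range l, a k| ≤ (m : ℝ) ^ 3 * B := by
  have hj : ∀ j ∈ range m, |∑ l ∈ range j, ∑ k ∈ range l, a k| ≤ (m : ℝ) * ((m : ℝ) * B) := by
    intro j hj
    have hjm : j < m := mem_range.mp hj
    refine (abs_sum_le_sum_abs _ _).trans ?_
    have hl : ∀ l ∈ range j, |∑ k ∈ range l, a k| ≤ (m : ℝ) * B := by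
      intro l hl
      have hlm : l < m := (mem_range.mp hl).trans hjm
      refine (abs_sum_le_sum_abs _ _).trans ?_
      calc ∑ k ∈ range l, |a k| ≤ ∑ _k ∈ range l, B := sum_le_sum fun k hk => h k ((mem_range.mp hk).trans hlm)
        _ = (l : ℝ) * B := by rw [sum_const, card_range, nsmul_eq_mul]
        _ ≤ (m : ℝ) * B := by gcongr
    calc ∑ l ∈ range j, |∑ k ∈ range l, a k| ≤ ∑ _l ∈ range j, (m : ℝ) * B := sum_le_sum hl
      _ = (j : ℝ) * ((m : ℝ) * B) := by rw [sum_const, card_range, nsmul_eq_mul]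
      _ ≤ (m : ℝ) * ((m : ℝ) * B) := by gcongr
  refine (abs_sum_le_sum_abs _ _).trans ?_
  calc ∑ j ∈ range m, |∑ l ∈ range j, ∑ k ∈ range l, a k| ≤ ∑ _j ∈ range m, (m : ℝ) * ((m : ℝ) * B) := sum_le_sum hj
    _ = (m : ℝ) ^ 3 * B := by rw [sum_const, card_range, nsmul_eq_mul]; ring

/-- [folklore] The backward triple sum (ranges `j+1`, `l+1`) of terms bounded by `B` is at most `n³·B` as well (indices `< n`). -/
theorem abs_sum₃_succ_le {n : ℕ} {a : ℕ → ℝ} {B : ℝ} (hB : 0 ≤ B) (h : ∀ k, k < n → |a k| ≤ B) :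
    |∑ j ∈ range n, ∑ l ∈ range (j + 1), ∑ k ∈ range (l + 1), a k| ≤ (n : ℝ) ^ 3 * B := by
  have hj : ∀ j ∈ range n, |∑ l ∈ range (j + 1), ∑ k ∈ range (l + 1), a k| ≤ (n : ℝ) * ((n : ℝ) * B) := by
    intro j hj
    have hjm : j < n := mem_range.mp hj
    refine (abs_sum_le_sum_abs _ _).trans ?_
    have hl : ∀ l ∈ range (j + 1), |∑ k ∈ range (l + 1), a k| ≤ (n : ℝ) * B := by
      intro l hl
      have hlm : l < n := lt_of_lt_of_le (Nat.lt_succ_iff.mp (mem_range.mp hl) |>.trans_lt (Nat.lt_succ_self j)) hjm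
      refine (abs_sum_le_sum_abs _ _).trans ?_
      calc ∑ k ∈ range (l + 1), |a k| ≤ ∑ _k ∈ range (l + 1), B :=
            sum_le_sum fun k hk => h k (lt_of_le_of_lt (Nat.lt_succ_iff.mp (mem_range.mp hk)) hlm)
        _ = ((l : ℝ) + 1) * B := by rw [sum_const, card_range, nsmul_eq_mul]; push_cast; ring
        _ ≤ (n : ℝ) * B := by gcongr; exact_mod_cast hlm
    calc ∑ l ∈ range (j + 1), |∑ k ∈ range (l + 1), a k| ≤ ∑ _l ∈ range (j + 1), (n : ℝ) * B := sum_le_sum hl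
      _ = ((j : ℝ) + 1) * ((n : ℝ) * B) := by rw [sum_const, card_range, nsmul_eq_mul]; push_cast; ring
      _ ≤ (n : ℝ) * ((n : ℝ) * B) := by gcongr; exact_mod_cast hjm
  refine (abs_sum_le_sum_abs _ _).trans ?_
  calc ∑ j ∈ range n, |∑ l ∈ range (j + 1), ∑ k ∈ range (l + 1), a k| ≤ ∑ _j ∈ range n, (n : ℝ) * ((n : ℝ) * B) := sum_le_sum hj
    _ = (n : ℝ) ^ 3 * B := by rw [sum_const, card_range, nsmul_eq_mul]; ring


/-- [folklore] A single range sum of terms bounded by `B` is at most `n·B`. -/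
theorem abs_sum₁_le {n : ℕ} {a : ℕ → ℝ} {B : ℝ} (h : ∀ k, k < n → |a k| ≤ B) :
    |∑ k ∈ range n, a k| ≤ (n : ℝ) * B := by
  refine (abs_sum_le_sum_abs _ _).trans ?_
  calc ∑ k ∈ range n, |a k| ≤ ∑ _k ∈ range n, B := sum_le_sum fun k hk => h k (mem_range.mp hk)
    _ = (n : ℝ) * B := by rw [sum_const, card_range, nsmul_eq_mul]

/-- [folklore] A double range sum (inner range `≤ n`) of terms bounded by `B` is at most `n²·B`. -/
theorem abs_sum₂_le {n : ℕ} {a : ℕ → ℝ} {B : ℝ} (hB : 0 ≤ B) {r : ℕ → ℕ} (hr : ∀ j, j < n → r j ≤ n)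
    (h : ∀ k, k < n → |a k| ≤ B) :
    |∑ j ∈ range n, ∑ k ∈ range (r j), a k| ≤ (n : ℝ) ^ 2 * B := by
  refine (abs_sum_le_sum_abs _ _).trans ?_
  have hj : ∀ j ∈ range n, |∑ k ∈ range (r j), a k| ≤ (n : ℝ) * B := by
    intro j hj
    have hjn := mem_range.mp hj
    refine (abs_sum_le_sum_abs _ _).trans ?_
    calc ∑ k ∈ range (r j), |a k| ≤ ∑ _k ∈ range (r j), B :=
          sum_le_sum fun k hk => h k (lt_of_lt_of_le (mem_range.mp hk) (hr j hjn))
      _ = (r j : ℝ) * B := by rw [sum_const, card_range, nsmul_eq_mul]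
      _ ≤ (n : ℝ) * B := by gcongr; exact_mod_cast hr j hjn
  calc ∑ j ∈ range n, |∑ k ∈ range (r j), a k| ≤ ∑ _j ∈ range n, (n : ℝ) * B := sum_le_sum hj
    _ = (n : ℝ) ^ 2 * B := by rw [sum_const, card_range, nsmul_eq_mul]; ring

/-- **ZEROTH-ORDER BOUND, every integer step**: if `|Δg k| ≤ B` on the integer segment between `0` and `m` then `|g m − g 0| ≤ |m|·B`. [folklore] -/
theorem abs_taylor0_le {B : ℝ} (m : ℤ) (h : ∀ k : ℤ, min m 0 ≤ k → k < max m 0 → |Δ_[1] g k| ≤ B) :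
    |g m - g 0| ≤ |(m : ℝ)| * B := by
  obtain ⟨n, rfl | rfl⟩ := Int.eq_nat_or_neg m
  · rw [sub_eq_sum_fwdDiff, Int.cast_natCast, Nat.abs_cast]
    exact abs_sum₁_le fun k hk => h k (by simp) (by simp; exact_mod_cast hk)
  · rw [sub_eq_neg_sum_fwdDiff_neg, abs_neg, Int.cast_neg, Int.cast_natCast, _root_.abs_neg, Nat.abs_cast]
    exact abs_sum₁_le fun k hk => h _ (by simp; omega) (by simp; omega)

/-- **FIRST-ORDER BOUND, every integer step**: if `|Δ²g k| ≤ B` on the integer segment between `0` and `m` then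
`|g m − g 0 − m·Δg 0| ≤ m²·B` — the Taylor polynomial uses the forward difference AT THE BASE POINT for both signs of `m`. [folklore] -/
theorem abs_taylor1_le {B : ℝ} (hB : 0 ≤ B) (m : ℤ)
    (h : ∀ k : ℤ, min m 0 ≤ k → k < max m 0 → |Δ_[1] (Δ_[1] g) k| ≤ B) :
    |g m - g 0 - (m : ℝ) * Δ_[1] g 0| ≤ (m : ℝ) ^ 2 * B := by
  obtain ⟨n, rfl | rfl⟩ := Int.eq_nat_or_neg m
  · rw [Int.cast_natCast, taylor1_eq_sum]
    exact abs_sum₂_le hB (fun j hj => hj.le) fun k hk => h k (by simp) (by simp; exact_mod_cast hk)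
  · rw [Int.cast_neg, Int.cast_natCast, neg_mul, sub_neg_eq_add, taylor1_neg_eq_sum, neg_sq]
    exact abs_sum₂_le hB (fun j hj => by omega) fun k hk => h _ (by simp; omega) (by simp; omega)

/-- **SECOND-ORDER BOUND, every integer step**: if `|Δ³g k| ≤ B` on the integer segment between `0` and `m` then
`|g m − g 0 − m·Δg 0 − (m(m−1)/2)·Δ²g 0| ≤ |m|³·B` — ONE Taylor polynomial in the forward differences at the base point for BOTH signs of `m`
(`m(m−1)/2 = n(n+1)/2` at `m = −n`). [folklore] -/
theorem abs_taylor2_le {B : ℝ} (hB : 0 ≤ B) (m : ℤ)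
    (h : ∀ k : ℤ, min m 0 ≤ k → k < max m 0 → |Δ_[1] (Δ_[1] (Δ_[1] g)) k| ≤ B) :
    |g m - g 0 - (m : ℝ) * Δ_[1] g 0 - ((m : ℝ) * ((m : ℝ) - 1) / 2) * Δ_[1] (Δ_[1] g) 0| ≤ |(m : ℝ)| ^ 3 * B := by
  obtain ⟨n, rfl | rfl⟩ := Int.eq_nat_or_neg m
  · rw [Int.cast_natCast, taylor2_eq_sum, Nat.abs_cast]
    exact abs_sum₃_le hB fun k hk => h k (by simp) (by simp; exact_mod_cast hk)
  · rw [Int.cast_neg, Int.cast_natCast, _root_.abs_neg, Nat.abs_cast]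
    have e : g (-(n : ℤ)) - g 0 - -(n : ℝ) * Δ_[1] g 0 - (-(n : ℝ) * (-(n : ℝ) - 1) / 2) * Δ_[1] (Δ_[1] g) 0
        = g (-(n : ℤ)) - g 0 + (n : ℝ) * Δ_[1] g 0 - ((n : ℝ) * ((n : ℝ) + 1) / 2) * Δ_[1] (Δ_[1] g) 0 := by ring
    rw [e, taylor2_neg_eq_sum, abs_neg]
    exact abs_sum₃_succ_le hB fun k hk => h _ (by simp; omega) (by simp; omega)

end OneDim

end Summit.QuantumFields.BalabanUV.Beta.FP.LatticeTaylor

end
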